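import Summits.BirchSwinnertonDyer.BirchSwinnertonDyer.Theorems.ResidualThetaTransportAtTwoSignedMuVanishingAtTwoPlusTrivialPlusSelmer
import Summits.BirchSwinnertonDyer.BirchSwinnertonDyer.Theorems.ByReductionTypeAtTwoSupersingularUnitAnchorClass157113h
import Summits.BirchSwinnertonDyer.BirchSwinnertonDyer.Theorems.ByReductionTypeAtTwoSupersingularUnitAnchorClass282093g
import Summits.BirchSwinnertonDyer.BirchSwinnertonDyer.Theorems.ByReductionTypeAtTwoSupersingularUnitAnchorClass455221c
import Summits.BirchSwinnertonDyer.BirchSwinnertonDyer.Theorems.ByReductionTypeAtTwoSupersingularUnitAnchorClass60725j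
import Summits.BirchSwinnertonDyer.BirchSwinnertonDyer.Theorems.ByReductionTypeAtTwoSupersingularUnitAnchorClass81305a
import Summits.BirchSwinnertonDyer.BirchSwinnertonDyer.Theorems.ByReductionTypeAtTwoSupersingularUnitAnchorClass137025s
import Summits.BirchSwinnertonDyer.BirchSwinnertonDyer.Theorems.ByReductionTypeAtTwoSupersingularUnitAnchorClass138039d
import Summits.BirchSwinnertonDyer.BirchSwinnertonDyer.Theorems.ByReductionTypeAtTwoSupersingularUnitAnchorClass216315r
import Summits.BirchSwinnertonDyer.BirchSwinnertonDyer.Theorems.ByReductionTypeAtTwoSupersingularUnitAnchorClass308025bk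
import Summits.BirchSwinnertonDyer.BirchSwinnertonDyer.Theorems.ByReductionTypeAtTwoSupersingularUnitAnchorClass347361g
import Summits.BirchSwinnertonDyer.BirchSwinnertonDyer.Theorems.ByReductionTypeAtTwoSupersingularUnitAnchorClass393129bo
import Summits.BirchSwinnertonDyer.BirchSwinnertonDyer.Theorems.ByReductionTypeAtTwoSupersingularUnitAnchorClass499555e
import HarnessLib

/-!
# Route `ResidualThetaTransportAtTwo`, crux Kμ⁺ `SignedMuVanishingAtTwoPlus` (stmt-BirchSwinnertonDyer-20689): CLASS INSTANCES of the
# descent-certificate road — conjunct 1 of Kμ⁺ AT the habitat⁺ classes **157113h** (anchor `27a1`), **282093g** and **455221c**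
# (anchor `19a1`) from {HONDA⁺@2(anchor), `Sel_{2^∞}(anchor/ℚ) = 0`, `2 ∤ Tam(anchor)`} — everything else kernel-decided

Cell `bsd-wall`, width seat `bsd-wall-rtt-p4-w2` (g2). The door is this seat's `muAlgebraicAt_of_partner_honda_descentCertificate`
(p588465, `…TrivialPlusSelmer`); the Galois-module congruences `W[2] ≅ A[2]` are cell `bsd-2adic`'s KERNEL-CHECKED Tschirnhaus
certificates (`SSUnitAnchor.twoTorsion_congruent_<W>_<A>`, UNIT-ANCHOR-CENSUS-v1; this seat's INSTRUMENT-SEED-PARTNERS-v1 reproduces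
the anchor list: 12/153 habitat⁺ classes carry an `a₂ = 0` unit-row congruent partner of conductor `< 5·10⁵`, these three are the
theta-habitat members among them); good supersingular reduction with `a₂ = 0`, minimality and `Δ < 0` are the kernel facts of
`…SupersingularColemanClass*` / `…UnitAnchorsA`. DISPLAYED hypotheses per class: HONDA⁺@2 at the ANCHOR (the registered research
stub `stub_plusHondaSystemTwo` of K4 `SignedControlAtTwo`, line `eulerchar` v6, read at the curve `A`) and the two CERTIFICATES
`A.selmerGroupPInfty 2 = ⊥` (2-descent; Cremona: rank 0, `#Ш_an(A) = 1`) and `2 ∤ ∏c_ℓ(A)` (Cremona: `∏c_ℓ(19a1) = ∏c_ℓ(27a1) = 3`).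
THEOREMS ONLY; instances, not bookings; closes nothing; BSD is not proved by any of this.

References: [GreenbergLNM1716] §3 Prop. 3.8; [GreenbergVatsal2000] Prop. (2.8); [Kobayashi2003] §8.4, Thm. 9.3; [BDKim2013] Cor. 3.15;
[CremonaAlgorithms1997] Table 1 (19a1, 27a1, 157113h1, 282093g1, 455221c1); [SilvermanAEC2009] III.§1, Cor. III.6.4(b).
-/

set_option autoImplicit false
set_option linter.dupNamespace false

noncomputable section

open scoped Classical NumberField

open NumberField IsDedekindDomain WeierstrassCurve Literature.NumberTheory.EllipticCurves
  Literature.NumberTheory.GaloisRepresentations ZpExtension Literature.NumberTheory.EllipticCurves.Kobayashi2003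
  Literature.NumberTheory.EllipticCurves.IwasawaAlgebra Literature.NumberTheory.EllipticCurves.Rank1Residual

namespace Summit.BirchSwinnertonDyer.BirchSwinnertonDyer.Theorems.SignedMuAtTwo

/-- **Conjunct 1 of Kμ⁺ AT `157113h1` from the unit anchor `27a1`**: granted a plus Honda system at `2` for `27a1` (HONDA⁺@2 read at the
anchor), `Sel_{2^∞}(27a1/ℚ) = 0` and `2 ∤ ∏c_ℓ(27a1)`, every finitely generated `+` signed Selmer dual of `157113h1` over the
cyclotomic `ℤ₂`-extension is `Λ`-torsion with `μ = 0`. Kernel: `157113h1` good supersingular at `2`, `a₂ = 0`, `Δ < 0`; `27a1` good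
supersingular at `2`, `a₂ = 0`; `157113h1[2] ≅ 27a1[2]` (`SSUnitAnchor.twoTorsion_congruent_157113h1_ua27a1`). [cite: GreenbergLNM1716, §3 Prop. 3.8]
[cite: GreenbergVatsal2000, Prop. (2.8)] [cite: Kobayashi2003, §8.4, Thm. 9.3] [cite: CremonaAlgorithms1997, Table 1] -/
theorem muAlgebraicAt_157113h1_of_honda_descentCertificate_27a1
    [((⟨0, 0, 1, 0, -7⟩ : WeierstrassCurve ℤ).baseChange ℚ).IsElliptic] [((⟨0, 0, 1, 0, -7⟩ : WeierstrassCurve ℤ).baseChange ℚ).IsGloballyMinimal]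
    (hHonda : ∀ κ : ZpExtension ℚ 2, κ.IsCyclotomic → ∀ (v : HeightOneSpectrum (𝓞 ℚ)), (2 : 𝓞 ℚ) ∈ v.asIdeal →
      ∃ d : ℕ → localPoints ((⟨0, 0, 1, 0, -7⟩ : WeierstrassCurve ℤ).baseChange ℚ) (v.adicCompletion ℚ),
        (∀ m, d m ∈ localLayerPointsOfEmb κ (closureEmb (K := ℚ) (v.adicCompletion ℚ)) ((⟨0, 0, 1, 0, -7⟩ : WeierstrassCurve ℤ).baseChange ℚ) m) ∧
        (∀ m, localTraceOfEmb κ (closureEmb (K := ℚ) (v.adicCompletion ℚ)) ((⟨0, 0, 1, 0, -7⟩ : WeierstrassCurve ℤ).baseChange ℚ) (m + 1) (m + 2) (d (m + 2)) = -d m) ∧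
        (∀ m : ℕ, 1 ≤ m → ∀ P ∈ localLayerPointsOfEmb κ (closureEmb (K := ℚ) (v.adicCompletion ℚ)) ((⟨0, 0, 1, 0, -7⟩ : WeierstrassCurve ℤ).baseChange ℚ) m,
          ∃ B ∈ AddSubgroup.closure (Set.range fun σ : Field.absoluteGaloisGroup (v.adicCompletion ℚ) ↦ σ • d m),
            ∃ P' ∈ localLayerPointsOfEmb κ (closureEmb (K := ℚ) (v.adicCompletion ℚ)) ((⟨0, 0, 1, 0, -7⟩ : WeierstrassCurve ℤ).baseChange ℚ) (m - 1),
            ∃ R ∈ localLayerPointsOfEmb κ (closureEmb (K := ℚ) (v.adicCompletion ℚ)) ((⟨0, 0, 1, 0, -7⟩ : WeierstrassCurve ℤ).baseChange ℚ) m, P = B + P' + 2 • R) ∧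
        (∀ P ∈ localLayerPointsOfEmb κ (closureEmb (K := ℚ) (v.adicCompletion ℚ)) ((⟨0, 0, 1, 0, -7⟩ : WeierstrassCurve ℤ).baseChange ℚ) 0,
          ∃ a : ℤ, ∃ R ∈ localLayerPointsOfEmb κ (closureEmb (K := ℚ) (v.adicCompletion ℚ)) ((⟨0, 0, 1, 0, -7⟩ : WeierstrassCurve ℤ).baseChange ℚ) 0, P = a • d 0 + 2 • R))
    (hSel : ((⟨0, 0, 1, 0, -7⟩ : WeierstrassCurve ℤ).baseChange ℚ).selmerGroupPInfty 2 = ⊥) (hTam : ¬ 2 ∣ ((⟨0, 0, 1, 0, -7⟩ : WeierstrassCurve ℤ).baseChange ℚ).tamagawaProduct) :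
    ∀ (κ : ZpExtension ℚ 2) (γ : Field.absoluteGaloisGroup ℚ), κ.IsCyclotomic → κ.IsTopGenerator γ →
      ∀ (D : SignedSelmerDualData ((⟨0, 0, 1, -2285565660, -42057036462382⟩ : WeierstrassCurve ℤ).baseChange ℚ) κ γ 1) [Module.Finite (IwasawaAlgebra 2) D.X],
        Module.IsTorsion (IwasawaAlgebra 2) D.X ∧ D.mu = 0 := by
  haveI := SSColemanRoad.isElliptic_157113h1
  haveI := SSColemanRoad.isGloballyMinimal_157113h1
  have hE := SSColemanRoad.goodSS_two_157113h1
  have hA := SSUnitAnchor.goodSS_two_ua27a1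
  have hΔ : ((⟨0, 0, 1, -2285565660, -42057036462382⟩ : WeierstrassCurve ℤ).baseChange ℚ).Δ < 0 := by
    rw [baseChange_int_Δ, SSColemanRoad.M157113h1_Δ]; norm_num
  exact muAlgebraicAt_of_partner_honda_descentCertificate _ _ hE.2.2 hE.2.1 hΔ hA.2.2 hA.2.1
    SSUnitAnchor.twoTorsion_congruent_157113h1_ua27a1 hHonda hSel hTam

/-- **Conjunct 1 of Kμ⁺ AT `282093g1` from the unit anchor `19a1`**: granted a plus Honda system at `2` for `19a1` (HONDA⁺@2 read at the
anchor), `Sel_{2^∞}(19a1/ℚ) = 0` and `2 ∤ ∏c_ℓ(19a1)`, every finitely generated `+` signed Selmer dual of `282093g1` over the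
cyclotomic `ℤ₂`-extension is `Λ`-torsion with `μ = 0`. Kernel: `282093g1` good supersingular at `2`, `a₂ = 0`, `Δ < 0`; `19a1` good
supersingular at `2`, `a₂ = 0`; `282093g1[2] ≅ 19a1[2]` (`SSUnitAnchor.twoTorsion_congruent_282093g1_ua19a1`). [cite: GreenbergLNM1716, §3 Prop. 3.8]
[cite: GreenbergVatsal2000, Prop. (2.8)] [cite: Kobayashi2003, §8.4, Thm. 9.3] [cite: CremonaAlgorithms1997, Table 1] -/
theorem muAlgebraicAt_282093g1_of_honda_descentCertificate_19a1
    [((⟨0, 1, 1, -9, -15⟩ : WeierstrassCurve ℤ).baseChange ℚ).IsElliptic] [((⟨0, 1, 1, -9, -15⟩ : WeierstrassCurve ℤ).baseChange ℚ).IsGloballyMinimal]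
    (hHonda : ∀ κ : ZpExtension ℚ 2, κ.IsCyclotomic → ∀ (v : HeightOneSpectrum (𝓞 ℚ)), (2 : 𝓞 ℚ) ∈ v.asIdeal →
      ∃ d : ℕ → localPoints ((⟨0, 1, 1, -9, -15⟩ : WeierstrassCurve ℤ).baseChange ℚ) (v.adicCompletion ℚ),
        (∀ m, d m ∈ localLayerPointsOfEmb κ (closureEmb (K := ℚ) (v.adicCompletion ℚ)) ((⟨0, 1, 1, -9, -15⟩ : WeierstrassCurve ℤ).baseChange ℚ) m) ∧
        (∀ m, localTraceOfEmb κ (closureEmb (K := ℚ) (v.adicCompletion ℚ)) ((⟨0, 1, 1, -9, -15⟩ : WeierstrassCurve ℤ).baseChange ℚ) (m + 1) (m + 2) (d (m + 2)) = -d m) ∧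
        (∀ m : ℕ, 1 ≤ m → ∀ P ∈ localLayerPointsOfEmb κ (closureEmb (K := ℚ) (v.adicCompletion ℚ)) ((⟨0, 1, 1, -9, -15⟩ : WeierstrassCurve ℤ).baseChange ℚ) m,
          ∃ B ∈ AddSubgroup.closure (Set.range fun σ : Field.absoluteGaloisGroup (v.adicCompletion ℚ) ↦ σ • d m),
            ∃ P' ∈ localLayerPointsOfEmb κ (closureEmb (K := ℚ) (v.adicCompletion ℚ)) ((⟨0, 1, 1, -9, -15⟩ : WeierstrassCurve ℤ).baseChange ℚ) (m - 1),
            ∃ R ∈ localLayerPointsOfEmb κ (closureEmb (K := ℚ) (v.adicCompletion ℚ)) ((⟨0, 1, 1, -9, -15⟩ : WeierstrassCurve ℤ).baseChange ℚ) m, P = B + P' + 2 • R) ∧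
        (∀ P ∈ localLayerPointsOfEmb κ (closureEmb (K := ℚ) (v.adicCompletion ℚ)) ((⟨0, 1, 1, -9, -15⟩ : WeierstrassCurve ℤ).baseChange ℚ) 0,
          ∃ a : ℤ, ∃ R ∈ localLayerPointsOfEmb κ (closureEmb (K := ℚ) (v.adicCompletion ℚ)) ((⟨0, 1, 1, -9, -15⟩ : WeierstrassCurve ℤ).baseChange ℚ) 0, P = a • d 0 + 2 • R))
    (hSel : ((⟨0, 1, 1, -9, -15⟩ : WeierstrassCurve ℤ).baseChange ℚ).selmerGroupPInfty 2 = ⊥) (hTam : ¬ 2 ∣ ((⟨0, 1, 1, -9, -15⟩ : WeierstrassCurve ℤ).baseChange ℚ).tamagawaProduct) :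
    ∀ (κ : ZpExtension ℚ 2) (γ : Field.absoluteGaloisGroup ℚ), κ.IsCyclotomic → κ.IsTopGenerator γ →
      ∀ (D : SignedSelmerDualData ((⟨0, -1, 1, 31451271, -719190590812⟩ : WeierstrassCurve ℤ).baseChange ℚ) κ γ 1) [Module.Finite (IwasawaAlgebra 2) D.X],
        Module.IsTorsion (IwasawaAlgebra 2) D.X ∧ D.mu = 0 := by
  haveI := SSColemanRoad.isElliptic_282093g1
  haveI := SSColemanRoad.isGloballyMinimal_282093g1
  have hE := SSColemanRoad.goodSS_two_282093g1
  have hA := SSUnitAnchor.goodSS_two_ua19a1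
  have hΔ : ((⟨0, -1, 1, 31451271, -719190590812⟩ : WeierstrassCurve ℤ).baseChange ℚ).Δ < 0 := by
    rw [baseChange_int_Δ, SSColemanRoad.M282093g1_Δ]; norm_num
  exact muAlgebraicAt_of_partner_honda_descentCertificate _ _ hE.2.2 hE.2.1 hΔ hA.2.2 hA.2.1
    SSUnitAnchor.twoTorsion_congruent_282093g1_ua19a1 hHonda hSel hTam

/-- **Conjunct 1 of Kμ⁺ AT `455221c1` from the unit anchor `19a1`**: granted a plus Honda system at `2` for `19a1` (HONDA⁺@2 read at the
anchor), `Sel_{2^∞}(19a1/ℚ) = 0` and `2 ∤ ∏c_ℓ(19a1)`, every finitely generated `+` signed Selmer dual of `455221c1` over the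
cyclotomic `ℤ₂`-extension is `Λ`-torsion with `μ = 0`. Kernel: `455221c1` good supersingular at `2`, `a₂ = 0`, `Δ < 0`; `19a1` good
supersingular at `2`, `a₂ = 0`; `455221c1[2] ≅ 19a1[2]` (`SSUnitAnchor.twoTorsion_congruent_455221c1_ua19a1`). [cite: GreenbergLNM1716, §3 Prop. 3.8]
[cite: GreenbergVatsal2000, Prop. (2.8)] [cite: Kobayashi2003, §8.4, Thm. 9.3] [cite: CremonaAlgorithms1997, Table 1] -/
theorem muAlgebraicAt_455221c1_of_honda_descentCertificate_19a1
    [((⟨0, 1, 1, -9, -15⟩ : WeierstrassCurve ℤ).baseChange ℚ).IsElliptic] [((⟨0, 1, 1, -9, -15⟩ : WeierstrassCurve ℤ).baseChange ℚ).IsGloballyMinimal]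
    (hHonda : ∀ κ : ZpExtension ℚ 2, κ.IsCyclotomic → ∀ (v : HeightOneSpectrum (𝓞 ℚ)), (2 : 𝓞 ℚ) ∈ v.asIdeal →
      ∃ d : ℕ → localPoints ((⟨0, 1, 1, -9, -15⟩ : WeierstrassCurve ℤ).baseChange ℚ) (v.adicCompletion ℚ),
        (∀ m, d m ∈ localLayerPointsOfEmb κ (closureEmb (K := ℚ) (v.adicCompletion ℚ)) ((⟨0, 1, 1, -9, -15⟩ : WeierstrassCurve ℤ).baseChange ℚ) m) ∧
        (∀ m, localTraceOfEmb κ (closureEmb (K := ℚ) (v.adicCompletion ℚ)) ((⟨0, 1, 1, -9, -15⟩ : WeierstrassCurve ℤ).baseChange ℚ) (m + 1) (m + 2) (d (m + 2)) = -d m) ∧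
        (∀ m : ℕ, 1 ≤ m → ∀ P ∈ localLayerPointsOfEmb κ (closureEmb (K := ℚ) (v.adicCompletion ℚ)) ((⟨0, 1, 1, -9, -15⟩ : WeierstrassCurve ℤ).baseChange ℚ) m,
          ∃ B ∈ AddSubgroup.closure (Set.range fun σ : Field.absoluteGaloisGroup (v.adicCompletion ℚ) ↦ σ • d m),
            ∃ P' ∈ localLayerPointsOfEmb κ (closureEmb (K := ℚ) (v.adicCompletion ℚ)) ((⟨0, 1, 1, -9, -15⟩ : WeierstrassCurve ℤ).baseChange ℚ) (m - 1),
            ∃ R ∈ localLayerPointsOfEmb κ (closureEmb (K := ℚ) (v.adicCompletion ℚ)) ((⟨0, 1, 1, -9, -15⟩ : WeierstrassCurve ℤ).baseChange ℚ) m, P = B + P' + 2 • R) ∧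
        (∀ P ∈ localLayerPointsOfEmb κ (closureEmb (K := ℚ) (v.adicCompletion ℚ)) ((⟨0, 1, 1, -9, -15⟩ : WeierstrassCurve ℤ).baseChange ℚ) 0,
          ∃ a : ℤ, ∃ R ∈ localLayerPointsOfEmb κ (closureEmb (K := ℚ) (v.adicCompletion ℚ)) ((⟨0, 1, 1, -9, -15⟩ : WeierstrassCurve ℤ).baseChange ℚ) 0, P = a • d 0 + 2 • R))
    (hSel : ((⟨0, 1, 1, -9, -15⟩ : WeierstrassCurve ℤ).baseChange ℚ).selmerGroupPInfty 2 = ⊥) (hTam : ¬ 2 ∣ ((⟨0, 1, 1, -9, -15⟩ : WeierstrassCurve ℤ).baseChange ℚ).tamagawaProduct) :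
    ∀ (κ : ZpExtension ℚ 2) (γ : Field.absoluteGaloisGroup ℚ), κ.IsCyclotomic → κ.IsTopGenerator γ →
      ∀ (D : SignedSelmerDualData ((⟨0, -1, 1, -1322079229, -18503736457912⟩ : WeierstrassCurve ℤ).baseChange ℚ) κ γ 1) [Module.Finite (IwasawaAlgebra 2) D.X],
        Module.IsTorsion (IwasawaAlgebra 2) D.X ∧ D.mu = 0 := by
  haveI := SSColemanRoad.isElliptic_455221c1
  haveI := SSColemanRoad.isGloballyMinimal_455221c1
  have hE := SSColemanRoad.goodSS_two_455221c1
  have hA := SSUnitAnchor.goodSS_two_ua19a1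
  have hΔ : ((⟨0, -1, 1, -1322079229, -18503736457912⟩ : WeierstrassCurve ℤ).baseChange ℚ).Δ < 0 := by
    rw [baseChange_int_Δ, SSColemanRoad.M455221c1_Δ]; norm_num
  exact muAlgebraicAt_of_partner_honda_descentCertificate _ _ hE.2.2 hE.2.1 hΔ hA.2.2 hA.2.1
    SSUnitAnchor.twoTorsion_congruent_455221c1_ua19a1 hHonda hSel hTam

/-! ## The nine further habitat⁺ classes with a unit anchor in Cremona's range (INSTRUMENT-SEED-PARTNERS-v1 / UNIT-ANCHOR-CENSUS-v1) -/

/-- **Conjunct 1 of Kμ⁺ AT `60725j1` from the unit anchor `35a1`** (HONDA⁺@2 at the anchor + `Sel_{2^∞}(35a1/ℚ) = 0` +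
`2 ∤ ∏c_ℓ(35a1)`; kernel: reduction data of both curves, `Δ(60725j1) < 0`, `60725j1[2] ≅ 35a1[2]` = `SSUnitAnchor.twoTorsion_congruent_60725j1_ua35a1`).
[cite: GreenbergLNM1716, §3 Prop. 3.8] [cite: GreenbergVatsal2000, Prop. (2.8)] [cite: Kobayashi2003, §8.4, Thm. 9.3] [cite: CremonaAlgorithms1997, Table 1] -/
theorem muAlgebraicAt_60725j1_of_honda_descentCertificate_35a1
    [((⟨0, 1, 1, 9, 1⟩ : WeierstrassCurve ℤ).baseChange ℚ).IsElliptic] [((⟨0, 1, 1, 9, 1⟩ : WeierstrassCurve ℤ).baseChange ℚ).IsGloballyMinimal]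
    (hHonda : ∀ κ : ZpExtension ℚ 2, κ.IsCyclotomic → ∀ (v : HeightOneSpectrum (𝓞 ℚ)), (2 : 𝓞 ℚ) ∈ v.asIdeal →
      ∃ d : ℕ → localPoints ((⟨0, 1, 1, 9, 1⟩ : WeierstrassCurve ℤ).baseChange ℚ) (v.adicCompletion ℚ),
        (∀ m, d m ∈ localLayerPointsOfEmb κ (closureEmb (K := ℚ) (v.adicCompletion ℚ)) ((⟨0, 1, 1, 9, 1⟩ : WeierstrassCurve ℤ).baseChange ℚ) m) ∧
        (∀ m, localTraceOfEmb κ (closureEmb (K := ℚ) (v.adicCompletion ℚ)) ((⟨0, 1, 1, 9, 1⟩ : WeierstrassCurve ℤ).baseChange ℚ) (m + 1) (m + 2) (d (m + 2)) = -d m) ∧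
        (∀ m : ℕ, 1 ≤ m → ∀ P ∈ localLayerPointsOfEmb κ (closureEmb (K := ℚ) (v.adicCompletion ℚ)) ((⟨0, 1, 1, 9, 1⟩ : WeierstrassCurve ℤ).baseChange ℚ) m,
          ∃ B ∈ AddSubgroup.closure (Set.range fun σ : Field.absoluteGaloisGroup (v.adicCompletion ℚ) ↦ σ • d m),
            ∃ P' ∈ localLayerPointsOfEmb κ (closureEmb (K := ℚ) (v.adicCompletion ℚ)) ((⟨0, 1, 1, 9, 1⟩ : WeierstrassCurve ℤ).baseChange ℚ) (m - 1),
            ∃ R ∈ localLayerPointsOfEmb κ (closureEmb (K := ℚ) (v.adicCompletion ℚ)) ((⟨0, 1, 1, 9, 1⟩ : WeierstrassCurve ℤ).baseChange ℚ) m, P = B + P' + 2 • R) ∧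
        (∀ P ∈ localLayerPointsOfEmb κ (closureEmb (K := ℚ) (v.adicCompletion ℚ)) ((⟨0, 1, 1, 9, 1⟩ : WeierstrassCurve ℤ).baseChange ℚ) 0,
          ∃ a : ℤ, ∃ R ∈ localLayerPointsOfEmb κ (closureEmb (K := ℚ) (v.adicCompletion ℚ)) ((⟨0, 1, 1, 9, 1⟩ : WeierstrassCurve ℤ).baseChange ℚ) 0, P = a • d 0 + 2 • R))
    (hSel : ((⟨0, 1, 1, 9, 1⟩ : WeierstrassCurve ℤ).baseChange ℚ).selmerGroupPInfty 2 = ⊥) (hTam : ¬ 2 ∣ ((⟨0, 1, 1, 9, 1⟩ : WeierstrassCurve ℤ).baseChange ℚ).tamagawaProduct) :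
    ∀ (κ : ZpExtension ℚ 2) (γ : Field.absoluteGaloisGroup ℚ), κ.IsCyclotomic → κ.IsTopGenerator γ →
      ∀ (D : SignedSelmerDualData ((⟨0, 1, 1, -26512333, -52552463631⟩ : WeierstrassCurve ℤ).baseChange ℚ) κ γ 1) [Module.Finite (IwasawaAlgebra 2) D.X],
        Module.IsTorsion (IwasawaAlgebra 2) D.X ∧ D.mu = 0 := by
  haveI := SSColemanRoad.isElliptic_60725j1
  haveI := SSColemanRoad.isGloballyMinimal_60725j1
  have hE := SSColemanRoad.goodSS_two_60725j1
  have hA := SSUnitAnchor.goodSS_two_ua35a1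
  have hΔ : ((⟨0, 1, 1, -26512333, -52552463631⟩ : WeierstrassCurve ℤ).baseChange ℚ).Δ < 0 := by
    rw [baseChange_int_Δ, SSColemanRoad.M60725j1_Δ]; norm_num
  exact muAlgebraicAt_of_partner_honda_descentCertificate _ _ hE.2.2 hE.2.1 hΔ hA.2.2 hA.2.1
    SSUnitAnchor.twoTorsion_congruent_60725j1_ua35a1 hHonda hSel hTam

/-- **Conjunct 1 of Kμ⁺ AT `81305a1` from the unit anchor `35a1`** (HONDA⁺@2 at the anchor + `Sel_{2^∞}(35a1/ℚ) = 0` +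
`2 ∤ ∏c_ℓ(35a1)`; kernel: reduction data of both curves, `Δ(81305a1) < 0`, `81305a1[2] ≅ 35a1[2]` = `SSUnitAnchor.twoTorsion_congruent_81305a1_ua35a1`).
[cite: GreenbergLNM1716, §3 Prop. 3.8] [cite: GreenbergVatsal2000, Prop. (2.8)] [cite: Kobayashi2003, §8.4, Thm. 9.3] [cite: CremonaAlgorithms1997, Table 1] -/
theorem muAlgebraicAt_81305a1_of_honda_descentCertificate_35a1
    [((⟨0, 1, 1, 9, 1⟩ : WeierstrassCurve ℤ).baseChange ℚ).IsElliptic] [((⟨0, 1, 1, 9, 1⟩ : WeierstrassCurve ℤ).baseChange ℚ).IsGloballyMinimal]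
    (hHonda : ∀ κ : ZpExtension ℚ 2, κ.IsCyclotomic → ∀ (v : HeightOneSpectrum (𝓞 ℚ)), (2 : 𝓞 ℚ) ∈ v.asIdeal →
      ∃ d : ℕ → localPoints ((⟨0, 1, 1, 9, 1⟩ : WeierstrassCurve ℤ).baseChange ℚ) (v.adicCompletion ℚ),
        (∀ m, d m ∈ localLayerPointsOfEmb κ (closureEmb (K := ℚ) (v.adicCompletion ℚ)) ((⟨0, 1, 1, 9, 1⟩ : WeierstrassCurve ℤ).baseChange ℚ) m) ∧
        (∀ m, localTraceOfEmb κ (closureEmb (K := ℚ) (v.adicCompletion ℚ)) ((⟨0, 1, 1, 9, 1⟩ : WeierstrassCurve ℤ).baseChange ℚ) (m + 1) (m + 2) (d (m + 2)) = -d m) ∧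
        (∀ m : ℕ, 1 ≤ m → ∀ P ∈ localLayerPointsOfEmb κ (closureEmb (K := ℚ) (v.adicCompletion ℚ)) ((⟨0, 1, 1, 9, 1⟩ : WeierstrassCurve ℤ).baseChange ℚ) m,
          ∃ B ∈ AddSubgroup.closure (Set.range fun σ : Field.absoluteGaloisGroup (v.adicCompletion ℚ) ↦ σ • d m),
            ∃ P' ∈ localLayerPointsOfEmb κ (closureEmb (K := ℚ) (v.adicCompletion ℚ)) ((⟨0, 1, 1, 9, 1⟩ : WeierstrassCurve ℤ).baseChange ℚ) (m - 1),
            ∃ R ∈ localLayerPointsOfEmb κ (closureEmb (K := ℚ) (v.adicCompletion ℚ)) ((⟨0, 1, 1, 9, 1⟩ : WeierstrassCurve ℤ).baseChange ℚ) m, P = B + P' + 2 • R) ∧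
        (∀ P ∈ localLayerPointsOfEmb κ (closureEmb (K := ℚ) (v.adicCompletion ℚ)) ((⟨0, 1, 1, 9, 1⟩ : WeierstrassCurve ℤ).baseChange ℚ) 0,
          ∃ a : ℤ, ∃ R ∈ localLayerPointsOfEmb κ (closureEmb (K := ℚ) (v.adicCompletion ℚ)) ((⟨0, 1, 1, 9, 1⟩ : WeierstrassCurve ℤ).baseChange ℚ) 0, P = a • d 0 + 2 • R))
    (hSel : ((⟨0, 1, 1, 9, 1⟩ : WeierstrassCurve ℤ).baseChange ℚ).selmerGroupPInfty 2 = ⊥) (hTam : ¬ 2 ∣ ((⟨0, 1, 1, 9, 1⟩ : WeierstrassCurve ℤ).baseChange ℚ).tamagawaProduct) :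
    ∀ (κ : ZpExtension ℚ 2) (γ : Field.absoluteGaloisGroup ℚ), κ.IsCyclotomic → κ.IsTopGenerator γ →
      ∀ (D : SignedSelmerDualData ((⟨0, 0, 1, -673395028, -6740510352317⟩ : WeierstrassCurve ℤ).baseChange ℚ) κ γ 1) [Module.Finite (IwasawaAlgebra 2) D.X],
        Module.IsTorsion (IwasawaAlgebra 2) D.X ∧ D.mu = 0 := by
  haveI := SSColemanRoad.isElliptic_81305a1
  haveI := SSColemanRoad.isGloballyMinimal_81305a1
  have hE := SSColemanRoad.goodSS_two_81305a1
  have hA := SSUnitAnchor.goodSS_two_ua35a1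
  have hΔ : ((⟨0, 0, 1, -673395028, -6740510352317⟩ : WeierstrassCurve ℤ).baseChange ℚ).Δ < 0 := by
    rw [baseChange_int_Δ, SSColemanRoad.M81305a1_Δ]; norm_num
  exact muAlgebraicAt_of_partner_honda_descentCertificate _ _ hE.2.2 hE.2.1 hΔ hA.2.2 hA.2.1
    SSUnitAnchor.twoTorsion_congruent_81305a1_ua35a1 hHonda hSel hTam

/-- **Conjunct 1 of Kμ⁺ AT `137025s1` from the unit anchor `3915c1`** (HONDA⁺@2 at the anchor + `Sel_{2^∞}(3915c1/ℚ) = 0` +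
`2 ∤ ∏c_ℓ(3915c1)`; kernel: reduction data of both curves, `Δ(137025s1) < 0`, `137025s1[2] ≅ 3915c1[2]` = `SSUnitAnchor.twoTorsion_congruent_137025s1_ua3915c1`).
[cite: GreenbergLNM1716, §3 Prop. 3.8] [cite: GreenbergVatsal2000, Prop. (2.8)] [cite: Kobayashi2003, §8.4, Thm. 9.3] [cite: CremonaAlgorithms1997, Table 1] -/
theorem muAlgebraicAt_137025s1_of_honda_descentCertificate_3915c1
    [((⟨0, 0, 1, -2538, 49214⟩ : WeierstrassCurve ℤ).baseChange ℚ).IsElliptic] [((⟨0, 0, 1, -2538, 49214⟩ : WeierstrassCurve ℤ).baseChange ℚ).IsGloballyMinimal]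
    (hHonda : ∀ κ : ZpExtension ℚ 2, κ.IsCyclotomic → ∀ (v : HeightOneSpectrum (𝓞 ℚ)), (2 : 𝓞 ℚ) ∈ v.asIdeal →
      ∃ d : ℕ → localPoints ((⟨0, 0, 1, -2538, 49214⟩ : WeierstrassCurve ℤ).baseChange ℚ) (v.adicCompletion ℚ),
        (∀ m, d m ∈ localLayerPointsOfEmb κ (closureEmb (K := ℚ) (v.adicCompletion ℚ)) ((⟨0, 0, 1, -2538, 49214⟩ : WeierstrassCurve ℤ).baseChange ℚ) m) ∧
        (∀ m, localTraceOfEmb κ (closureEmb (K := ℚ) (v.adicCompletion ℚ)) ((⟨0, 0, 1, -2538, 49214⟩ : WeierstrassCurve ℤ).baseChange ℚ) (m + 1) (m + 2) (d (m + 2)) = -d m) ∧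
        (∀ m : ℕ, 1 ≤ m → ∀ P ∈ localLayerPointsOfEmb κ (closureEmb (K := ℚ) (v.adicCompletion ℚ)) ((⟨0, 0, 1, -2538, 49214⟩ : WeierstrassCurve ℤ).baseChange ℚ) m,
          ∃ B ∈ AddSubgroup.closure (Set.range fun σ : Field.absoluteGaloisGroup (v.adicCompletion ℚ) ↦ σ • d m),
            ∃ P' ∈ localLayerPointsOfEmb κ (closureEmb (K := ℚ) (v.adicCompletion ℚ)) ((⟨0, 0, 1, -2538, 49214⟩ : WeierstrassCurve ℤ).baseChange ℚ) (m - 1),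
            ∃ R ∈ localLayerPointsOfEmb κ (closureEmb (K := ℚ) (v.adicCompletion ℚ)) ((⟨0, 0, 1, -2538, 49214⟩ : WeierstrassCurve ℤ).baseChange ℚ) m, P = B + P' + 2 • R) ∧
        (∀ P ∈ localLayerPointsOfEmb κ (closureEmb (K := ℚ) (v.adicCompletion ℚ)) ((⟨0, 0, 1, -2538, 49214⟩ : WeierstrassCurve ℤ).baseChange ℚ) 0,
          ∃ a : ℤ, ∃ R ∈ localLayerPointsOfEmb κ (closureEmb (K := ℚ) (v.adicCompletion ℚ)) ((⟨0, 0, 1, -2538, 49214⟩ : WeierstrassCurve ℤ).baseChange ℚ) 0, P = a • d 0 + 2 • R))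
    (hSel : ((⟨0, 0, 1, -2538, 49214⟩ : WeierstrassCurve ℤ).baseChange ℚ).selmerGroupPInfty 2 = ⊥) (hTam : ¬ 2 ∣ ((⟨0, 0, 1, -2538, 49214⟩ : WeierstrassCurve ℤ).baseChange ℚ).tamagawaProduct) :
    ∀ (κ : ZpExtension ℚ 2) (γ : Field.absoluteGaloisGroup ℚ), κ.IsCyclotomic → κ.IsTopGenerator γ →
      ∀ (D : SignedSelmerDualData ((⟨0, 0, 1, -3894750, -3091521094⟩ : WeierstrassCurve ℤ).baseChange ℚ) κ γ 1) [Module.Finite (IwasawaAlgebra 2) D.X],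
        Module.IsTorsion (IwasawaAlgebra 2) D.X ∧ D.mu = 0 := by
  haveI := SSColemanRoad.isElliptic_137025s1
  haveI := SSColemanRoad.isGloballyMinimal_137025s1
  have hE := SSColemanRoad.goodSS_two_137025s1
  have hA := SSUnitAnchor.goodSS_two_ua3915c1
  have hΔ : ((⟨0, 0, 1, -3894750, -3091521094⟩ : WeierstrassCurve ℤ).baseChange ℚ).Δ < 0 := by
    rw [baseChange_int_Δ, SSColemanRoad.M137025s1_Δ]; norm_num
  exact muAlgebraicAt_of_partner_honda_descentCertificate _ _ hE.2.2 hE.2.1 hΔ hA.2.2 hA.2.1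
    SSUnitAnchor.twoTorsion_congruent_137025s1_ua3915c1 hHonda hSel hTam

/-- **Conjunct 1 of Kμ⁺ AT `138039d1` from the unit anchor `267a1`** (HONDA⁺@2 at the anchor + `Sel_{2^∞}(267a1/ℚ) = 0` +
`2 ∤ ∏c_ℓ(267a1)`; kernel: reduction data of both curves, `Δ(138039d1) < 0`, `138039d1[2] ≅ 267a1[2]` = `SSUnitAnchor.twoTorsion_congruent_138039d1_ua267a1`).
[cite: GreenbergLNM1716, §3 Prop. 3.8] [cite: GreenbergVatsal2000, Prop. (2.8)] [cite: Kobayashi2003, §8.4, Thm. 9.3] [cite: CremonaAlgorithms1997, Table 1] -/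
theorem muAlgebraicAt_138039d1_of_honda_descentCertificate_267a1
    [((⟨0, 1, 1, -3, 2⟩ : WeierstrassCurve ℤ).baseChange ℚ).IsElliptic] [((⟨0, 1, 1, -3, 2⟩ : WeierstrassCurve ℤ).baseChange ℚ).IsGloballyMinimal]
    (hHonda : ∀ κ : ZpExtension ℚ 2, κ.IsCyclotomic → ∀ (v : HeightOneSpectrum (𝓞 ℚ)), (2 : 𝓞 ℚ) ∈ v.asIdeal →
      ∃ d : ℕ → localPoints ((⟨0, 1, 1, -3, 2⟩ : WeierstrassCurve ℤ).baseChange ℚ) (v.adicCompletion ℚ),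
        (∀ m, d m ∈ localLayerPointsOfEmb κ (closureEmb (K := ℚ) (v.adicCompletion ℚ)) ((⟨0, 1, 1, -3, 2⟩ : WeierstrassCurve ℤ).baseChange ℚ) m) ∧
        (∀ m, localTraceOfEmb κ (closureEmb (K := ℚ) (v.adicCompletion ℚ)) ((⟨0, 1, 1, -3, 2⟩ : WeierstrassCurve ℤ).baseChange ℚ) (m + 1) (m + 2) (d (m + 2)) = -d m) ∧
        (∀ m : ℕ, 1 ≤ m → ∀ P ∈ localLayerPointsOfEmb κ (closureEmb (K := ℚ) (v.adicCompletion ℚ)) ((⟨0, 1, 1, -3, 2⟩ : WeierstrassCurve ℤ).baseChange ℚ) m,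
          ∃ B ∈ AddSubgroup.closure (Set.range fun σ : Field.absoluteGaloisGroup (v.adicCompletion ℚ) ↦ σ • d m),
            ∃ P' ∈ localLayerPointsOfEmb κ (closureEmb (K := ℚ) (v.adicCompletion ℚ)) ((⟨0, 1, 1, -3, 2⟩ : WeierstrassCurve ℤ).baseChange ℚ) (m - 1),
            ∃ R ∈ localLayerPointsOfEmb κ (closureEmb (K := ℚ) (v.adicCompletion ℚ)) ((⟨0, 1, 1, -3, 2⟩ : WeierstrassCurve ℤ).baseChange ℚ) m, P = B + P' + 2 • R) ∧
        (∀ P ∈ localLayerPointsOfEmb κ (closureEmb (K := ℚ) (v.adicCompletion ℚ)) ((⟨0, 1, 1, -3, 2⟩ : WeierstrassCurve ℤ).baseChange ℚ) 0,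
          ∃ a : ℤ, ∃ R ∈ localLayerPointsOfEmb κ (closureEmb (K := ℚ) (v.adicCompletion ℚ)) ((⟨0, 1, 1, -3, 2⟩ : WeierstrassCurve ℤ).baseChange ℚ) 0, P = a • d 0 + 2 • R))
    (hSel : ((⟨0, 1, 1, -3, 2⟩ : WeierstrassCurve ℤ).baseChange ℚ).selmerGroupPInfty 2 = ⊥) (hTam : ¬ 2 ∣ ((⟨0, 1, 1, -3, 2⟩ : WeierstrassCurve ℤ).baseChange ℚ).tamagawaProduct) :
    ∀ (κ : ZpExtension ℚ 2) (γ : Field.absoluteGaloisGroup ℚ), κ.IsCyclotomic → κ.IsTopGenerator γ →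
      ∀ (D : SignedSelmerDualData ((⟨0, -1, 1, -1371241451, -19543793107831⟩ : WeierstrassCurve ℤ).baseChange ℚ) κ γ 1) [Module.Finite (IwasawaAlgebra 2) D.X],
        Module.IsTorsion (IwasawaAlgebra 2) D.X ∧ D.mu = 0 := by
  haveI := SSColemanRoad.isElliptic_138039d1
  haveI := SSColemanRoad.isGloballyMinimal_138039d1
  have hE := SSColemanRoad.goodSS_two_138039d1
  have hA := SSUnitAnchor.goodSS_two_ua267a1
  have hΔ : ((⟨0, -1, 1, -1371241451, -19543793107831⟩ : WeierstrassCurve ℤ).baseChange ℚ).Δ < 0 := by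
    rw [baseChange_int_Δ, SSColemanRoad.M138039d1_Δ]; norm_num
  exact muAlgebraicAt_of_partner_honda_descentCertificate _ _ hE.2.2 hE.2.1 hΔ hA.2.2 hA.2.1
    SSUnitAnchor.twoTorsion_congruent_138039d1_ua267a1 hHonda hSel hTam

/-- **Conjunct 1 of Kμ⁺ AT `216315r1` from the unit anchor `6555e1`** (HONDA⁺@2 at the anchor + `Sel_{2^∞}(6555e1/ℚ) = 0` +
`2 ∤ ∏c_ℓ(6555e1)`; kernel: reduction data of both curves, `Δ(216315r1) < 0`, `216315r1[2] ≅ 6555e1[2]` = `SSUnitAnchor.twoTorsion_congruent_216315r1_ua6555e1`).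
[cite: GreenbergLNM1716, §3 Prop. 3.8] [cite: GreenbergVatsal2000, Prop. (2.8)] [cite: Kobayashi2003, §8.4, Thm. 9.3] [cite: CremonaAlgorithms1997, Table 1] -/
theorem muAlgebraicAt_216315r1_of_honda_descentCertificate_6555e1
    [((⟨0, -1, 1, -33735977475, -2384987222304844⟩ : WeierstrassCurve ℤ).baseChange ℚ).IsElliptic] [((⟨0, -1, 1, -33735977475, -2384987222304844⟩ : WeierstrassCurve ℤ).baseChange ℚ).IsGloballyMinimal]
    (hHonda : ∀ κ : ZpExtension ℚ 2, κ.IsCyclotomic → ∀ (v : HeightOneSpectrum (𝓞 ℚ)), (2 : 𝓞 ℚ) ∈ v.asIdeal →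
      ∃ d : ℕ → localPoints ((⟨0, -1, 1, -33735977475, -2384987222304844⟩ : WeierstrassCurve ℤ).baseChange ℚ) (v.adicCompletion ℚ),
        (∀ m, d m ∈ localLayerPointsOfEmb κ (closureEmb (K := ℚ) (v.adicCompletion ℚ)) ((⟨0, -1, 1, -33735977475, -2384987222304844⟩ : WeierstrassCurve ℤ).baseChange ℚ) m) ∧
        (∀ m, localTraceOfEmb κ (closureEmb (K := ℚ) (v.adicCompletion ℚ)) ((⟨0, -1, 1, -33735977475, -2384987222304844⟩ : WeierstrassCurve ℤ).baseChange ℚ) (m + 1) (m + 2) (d (m + 2)) = -d m) ∧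
        (∀ m : ℕ, 1 ≤ m → ∀ P ∈ localLayerPointsOfEmb κ (closureEmb (K := ℚ) (v.adicCompletion ℚ)) ((⟨0, -1, 1, -33735977475, -2384987222304844⟩ : WeierstrassCurve ℤ).baseChange ℚ) m,
          ∃ B ∈ AddSubgroup.closure (Set.range fun σ : Field.absoluteGaloisGroup (v.adicCompletion ℚ) ↦ σ • d m),
            ∃ P' ∈ localLayerPointsOfEmb κ (closureEmb (K := ℚ) (v.adicCompletion ℚ)) ((⟨0, -1, 1, -33735977475, -2384987222304844⟩ : WeierstrassCurve ℤ).baseChange ℚ) (m - 1),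
            ∃ R ∈ localLayerPointsOfEmb κ (closureEmb (K := ℚ) (v.adicCompletion ℚ)) ((⟨0, -1, 1, -33735977475, -2384987222304844⟩ : WeierstrassCurve ℤ).baseChange ℚ) m, P = B + P' + 2 • R) ∧
        (∀ P ∈ localLayerPointsOfEmb κ (closureEmb (K := ℚ) (v.adicCompletion ℚ)) ((⟨0, -1, 1, -33735977475, -2384987222304844⟩ : WeierstrassCurve ℤ).baseChange ℚ) 0,
          ∃ a : ℤ, ∃ R ∈ localLayerPointsOfEmb κ (closureEmb (K := ℚ) (v.adicCompletion ℚ)) ((⟨0, -1, 1, -33735977475, -2384987222304844⟩ : WeierstrassCurve ℤ).baseChange ℚ) 0, P = a • d 0 + 2 • R))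
    (hSel : ((⟨0, -1, 1, -33735977475, -2384987222304844⟩ : WeierstrassCurve ℤ).baseChange ℚ).selmerGroupPInfty 2 = ⊥) (hTam : ¬ 2 ∣ ((⟨0, -1, 1, -33735977475, -2384987222304844⟩ : WeierstrassCurve ℤ).baseChange ℚ).tamagawaProduct) :
    ∀ (κ : ZpExtension ℚ 2) (γ : Field.absoluteGaloisGroup ℚ), κ.IsCyclotomic → κ.IsTopGenerator γ →
      ∀ (D : SignedSelmerDualData ((⟨0, 0, 1, -978016308, 13010308542524⟩ : WeierstrassCurve ℤ).baseChange ℚ) κ γ 1) [Module.Finite (IwasawaAlgebra 2) D.X],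
        Module.IsTorsion (IwasawaAlgebra 2) D.X ∧ D.mu = 0 := by
  haveI := SSColemanRoad.isElliptic_216315r1
  haveI := SSColemanRoad.isGloballyMinimal_216315r1
  have hE := SSColemanRoad.goodSS_two_216315r1
  have hA := SSUnitAnchor.goodSS_two_ua6555e1
  have hΔ : ((⟨0, 0, 1, -978016308, 13010308542524⟩ : WeierstrassCurve ℤ).baseChange ℚ).Δ < 0 := by
    rw [baseChange_int_Δ, SSColemanRoad.M216315r1_Δ]; norm_num
  exact muAlgebraicAt_of_partner_honda_descentCertificate _ _ hE.2.2 hE.2.1 hΔ hA.2.2 hA.2.1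
    SSUnitAnchor.twoTorsion_congruent_216315r1_ua6555e1 hHonda hSel hTam

/-- **Conjunct 1 of Kμ⁺ AT `308025bk1` from the unit anchor `555a1`** (HONDA⁺@2 at the anchor + `Sel_{2^∞}(555a1/ℚ) = 0` +
`2 ∤ ∏c_ℓ(555a1)`; kernel: reduction data of both curves, `Δ(308025bk1) < 0`, `308025bk1[2] ≅ 555a1[2]` = `SSUnitAnchor.twoTorsion_congruent_308025bk1_ua555a1`).
[cite: GreenbergLNM1716, §3 Prop. 3.8] [cite: GreenbergVatsal2000, Prop. (2.8)] [cite: Kobayashi2003, §8.4, Thm. 9.3] [cite: CremonaAlgorithms1997, Table 1] -/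
theorem muAlgebraicAt_308025bk1_of_honda_descentCertificate_555a1
    [((⟨0, 1, 1, -1, -29⟩ : WeierstrassCurve ℤ).baseChange ℚ).IsElliptic] [((⟨0, 1, 1, -1, -29⟩ : WeierstrassCurve ℤ).baseChange ℚ).IsGloballyMinimal]
    (hHonda : ∀ κ : ZpExtension ℚ 2, κ.IsCyclotomic → ∀ (v : HeightOneSpectrum (𝓞 ℚ)), (2 : 𝓞 ℚ) ∈ v.asIdeal →
      ∃ d : ℕ → localPoints ((⟨0, 1, 1, -1, -29⟩ : WeierstrassCurve ℤ).baseChange ℚ) (v.adicCompletion ℚ),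
        (∀ m, d m ∈ localLayerPointsOfEmb κ (closureEmb (K := ℚ) (v.adicCompletion ℚ)) ((⟨0, 1, 1, -1, -29⟩ : WeierstrassCurve ℤ).baseChange ℚ) m) ∧
        (∀ m, localTraceOfEmb κ (closureEmb (K := ℚ) (v.adicCompletion ℚ)) ((⟨0, 1, 1, -1, -29⟩ : WeierstrassCurve ℤ).baseChange ℚ) (m + 1) (m + 2) (d (m + 2)) = -d m) ∧
        (∀ m : ℕ, 1 ≤ m → ∀ P ∈ localLayerPointsOfEmb κ (closureEmb (K := ℚ) (v.adicCompletion ℚ)) ((⟨0, 1, 1, -1, -29⟩ : WeierstrassCurve ℤ).baseChange ℚ) m,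
          ∃ B ∈ AddSubgroup.closure (Set.range fun σ : Field.absoluteGaloisGroup (v.adicCompletion ℚ) ↦ σ • d m),
            ∃ P' ∈ localLayerPointsOfEmb κ (closureEmb (K := ℚ) (v.adicCompletion ℚ)) ((⟨0, 1, 1, -1, -29⟩ : WeierstrassCurve ℤ).baseChange ℚ) (m - 1),
            ∃ R ∈ localLayerPointsOfEmb κ (closureEmb (K := ℚ) (v.adicCompletion ℚ)) ((⟨0, 1, 1, -1, -29⟩ : WeierstrassCurve ℤ).baseChange ℚ) m, P = B + P' + 2 • R) ∧
        (∀ P ∈ localLayerPointsOfEmb κ (closureEmb (K := ℚ) (v.adicCompletion ℚ)) ((⟨0, 1, 1, -1, -29⟩ : WeierstrassCurve ℤ).baseChange ℚ) 0,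
          ∃ a : ℤ, ∃ R ∈ localLayerPointsOfEmb κ (closureEmb (K := ℚ) (v.adicCompletion ℚ)) ((⟨0, 1, 1, -1, -29⟩ : WeierstrassCurve ℤ).baseChange ℚ) 0, P = a • d 0 + 2 • R))
    (hSel : ((⟨0, 1, 1, -1, -29⟩ : WeierstrassCurve ℤ).baseChange ℚ).selmerGroupPInfty 2 = ⊥) (hTam : ¬ 2 ∣ ((⟨0, 1, 1, -1, -29⟩ : WeierstrassCurve ℤ).baseChange ℚ).tamagawaProduct) :
    ∀ (κ : ZpExtension ℚ 2) (γ : Field.absoluteGaloisGroup ℚ), κ.IsCyclotomic → κ.IsTopGenerator γ →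
      ∀ (D : SignedSelmerDualData ((⟨0, 0, 1, -36963000, -86545399219⟩ : WeierstrassCurve ℤ).baseChange ℚ) κ γ 1) [Module.Finite (IwasawaAlgebra 2) D.X],
        Module.IsTorsion (IwasawaAlgebra 2) D.X ∧ D.mu = 0 := by
  haveI := SSColemanRoad.isElliptic_308025bk1
  haveI := SSColemanRoad.isGloballyMinimal_308025bk1
  have hE := SSColemanRoad.goodSS_two_308025bk1
  have hA := SSUnitAnchor.goodSS_two_ua555a1
  have hΔ : ((⟨0, 0, 1, -36963000, -86545399219⟩ : WeierstrassCurve ℤ).baseChange ℚ).Δ < 0 := by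
    rw [baseChange_int_Δ, SSColemanRoad.M308025bk1_Δ]; norm_num
  exact muAlgebraicAt_of_partner_honda_descentCertificate _ _ hE.2.2 hE.2.1 hΔ hA.2.2 hA.2.1
    SSUnitAnchor.twoTorsion_congruent_308025bk1_ua555a1 hHonda hSel hTam

/-- **Conjunct 1 of Kμ⁺ AT `347361g1` from the unit anchor `51a1`** (HONDA⁺@2 at the anchor + `Sel_{2^∞}(51a1/ℚ) = 0` +
`2 ∤ ∏c_ℓ(51a1)`; kernel: reduction data of both curves, `Δ(347361g1) < 0`, `347361g1[2] ≅ 51a1[2]` = `SSUnitAnchor.twoTorsion_congruent_347361g1_ua51a1`).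
[cite: GreenbergLNM1716, §3 Prop. 3.8] [cite: GreenbergVatsal2000, Prop. (2.8)] [cite: Kobayashi2003, §8.4, Thm. 9.3] [cite: CremonaAlgorithms1997, Table 1] -/
theorem muAlgebraicAt_347361g1_of_honda_descentCertificate_51a1
    [((⟨0, 1, 1, 1, -1⟩ : WeierstrassCurve ℤ).baseChange ℚ).IsElliptic] [((⟨0, 1, 1, 1, -1⟩ : WeierstrassCurve ℤ).baseChange ℚ).IsGloballyMinimal]
    (hHonda : ∀ κ : ZpExtension ℚ 2, κ.IsCyclotomic → ∀ (v : HeightOneSpectrum (𝓞 ℚ)), (2 : 𝓞 ℚ) ∈ v.asIdeal →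
      ∃ d : ℕ → localPoints ((⟨0, 1, 1, 1, -1⟩ : WeierstrassCurve ℤ).baseChange ℚ) (v.adicCompletion ℚ),
        (∀ m, d m ∈ localLayerPointsOfEmb κ (closureEmb (K := ℚ) (v.adicCompletion ℚ)) ((⟨0, 1, 1, 1, -1⟩ : WeierstrassCurve ℤ).baseChange ℚ) m) ∧
        (∀ m, localTraceOfEmb κ (closureEmb (K := ℚ) (v.adicCompletion ℚ)) ((⟨0, 1, 1, 1, -1⟩ : WeierstrassCurve ℤ).baseChange ℚ) (m + 1) (m + 2) (d (m + 2)) = -d m) ∧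
        (∀ m : ℕ, 1 ≤ m → ∀ P ∈ localLayerPointsOfEmb κ (closureEmb (K := ℚ) (v.adicCompletion ℚ)) ((⟨0, 1, 1, 1, -1⟩ : WeierstrassCurve ℤ).baseChange ℚ) m,
          ∃ B ∈ AddSubgroup.closure (Set.range fun σ : Field.absoluteGaloisGroup (v.adicCompletion ℚ) ↦ σ • d m),
            ∃ P' ∈ localLayerPointsOfEmb κ (closureEmb (K := ℚ) (v.adicCompletion ℚ)) ((⟨0, 1, 1, 1, -1⟩ : WeierstrassCurve ℤ).baseChange ℚ) (m - 1),
            ∃ R ∈ localLayerPointsOfEmb κ (closureEmb (K := ℚ) (v.adicCompletion ℚ)) ((⟨0, 1, 1, 1, -1⟩ : WeierstrassCurve ℤ).baseChange ℚ) m, P = B + P' + 2 • R) ∧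
        (∀ P ∈ localLayerPointsOfEmb κ (closureEmb (K := ℚ) (v.adicCompletion ℚ)) ((⟨0, 1, 1, 1, -1⟩ : WeierstrassCurve ℤ).baseChange ℚ) 0,
          ∃ a : ℤ, ∃ R ∈ localLayerPointsOfEmb κ (closureEmb (K := ℚ) (v.adicCompletion ℚ)) ((⟨0, 1, 1, 1, -1⟩ : WeierstrassCurve ℤ).baseChange ℚ) 0, P = a • d 0 + 2 • R))
    (hSel : ((⟨0, 1, 1, 1, -1⟩ : WeierstrassCurve ℤ).baseChange ℚ).selmerGroupPInfty 2 = ⊥) (hTam : ¬ 2 ∣ ((⟨0, 1, 1, 1, -1⟩ : WeierstrassCurve ℤ).baseChange ℚ).tamagawaProduct) :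
    ∀ (κ : ZpExtension ℚ 2) (γ : Field.absoluteGaloisGroup ℚ), κ.IsCyclotomic → κ.IsTopGenerator γ →
      ∀ (D : SignedSelmerDualData ((⟨0, -1, 1, -32210705, -70352938111⟩ : WeierstrassCurve ℤ).baseChange ℚ) κ γ 1) [Module.Finite (IwasawaAlgebra 2) D.X],
        Module.IsTorsion (IwasawaAlgebra 2) D.X ∧ D.mu = 0 := by
  haveI := SSColemanRoad.isElliptic_347361g1
  haveI := SSColemanRoad.isGloballyMinimal_347361g1
  have hE := SSColemanRoad.goodSS_two_347361g1
  have hA := SSUnitAnchor.goodSS_two_ua51a1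
  have hΔ : ((⟨0, -1, 1, -32210705, -70352938111⟩ : WeierstrassCurve ℤ).baseChange ℚ).Δ < 0 := by
    rw [baseChange_int_Δ, SSColemanRoad.M347361g1_Δ]; norm_num
  exact muAlgebraicAt_of_partner_honda_descentCertificate _ _ hE.2.2 hE.2.1 hΔ hA.2.2 hA.2.1
    SSUnitAnchor.twoTorsion_congruent_347361g1_ua51a1 hHonda hSel hTam

/-- **Conjunct 1 of Kμ⁺ AT `393129bo1` from the unit anchor `627a1`** (HONDA⁺@2 at the anchor + `Sel_{2^∞}(627a1/ℚ) = 0` +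
`2 ∤ ∏c_ℓ(627a1)`; kernel: reduction data of both curves, `Δ(393129bo1) < 0`, `393129bo1[2] ≅ 627a1[2]` = `SSUnitAnchor.twoTorsion_congruent_393129bo1_ua627a1`).
[cite: GreenbergLNM1716, §3 Prop. 3.8] [cite: GreenbergVatsal2000, Prop. (2.8)] [cite: Kobayashi2003, §8.4, Thm. 9.3] [cite: CremonaAlgorithms1997, Table 1] -/
theorem muAlgebraicAt_393129bo1_of_honda_descentCertificate_627a1
    [((⟨0, 1, 1, -1, -2⟩ : WeierstrassCurve ℤ).baseChange ℚ).IsElliptic] [((⟨0, 1, 1, -1, -2⟩ : WeierstrassCurve ℤ).baseChange ℚ).IsGloballyMinimal]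
    (hHonda : ∀ κ : ZpExtension ℚ 2, κ.IsCyclotomic → ∀ (v : HeightOneSpectrum (𝓞 ℚ)), (2 : 𝓞 ℚ) ∈ v.asIdeal →
      ∃ d : ℕ → localPoints ((⟨0, 1, 1, -1, -2⟩ : WeierstrassCurve ℤ).baseChange ℚ) (v.adicCompletion ℚ),
        (∀ m, d m ∈ localLayerPointsOfEmb κ (closureEmb (K := ℚ) (v.adicCompletion ℚ)) ((⟨0, 1, 1, -1, -2⟩ : WeierstrassCurve ℤ).baseChange ℚ) m) ∧
        (∀ m, localTraceOfEmb κ (closureEmb (K := ℚ) (v.adicCompletion ℚ)) ((⟨0, 1, 1, -1, -2⟩ : WeierstrassCurve ℤ).baseChange ℚ) (m + 1) (m + 2) (d (m + 2)) = -d m) ∧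
        (∀ m : ℕ, 1 ≤ m → ∀ P ∈ localLayerPointsOfEmb κ (closureEmb (K := ℚ) (v.adicCompletion ℚ)) ((⟨0, 1, 1, -1, -2⟩ : WeierstrassCurve ℤ).baseChange ℚ) m,
          ∃ B ∈ AddSubgroup.closure (Set.range fun σ : Field.absoluteGaloisGroup (v.adicCompletion ℚ) ↦ σ • d m),
            ∃ P' ∈ localLayerPointsOfEmb κ (closureEmb (K := ℚ) (v.adicCompletion ℚ)) ((⟨0, 1, 1, -1, -2⟩ : WeierstrassCurve ℤ).baseChange ℚ) (m - 1),
            ∃ R ∈ localLayerPointsOfEmb κ (closureEmb (K := ℚ) (v.adicCompletion ℚ)) ((⟨0, 1, 1, -1, -2⟩ : WeierstrassCurve ℤ).baseChange ℚ) m, P = B + P' + 2 • R) ∧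
        (∀ P ∈ localLayerPointsOfEmb κ (closureEmb (K := ℚ) (v.adicCompletion ℚ)) ((⟨0, 1, 1, -1, -2⟩ : WeierstrassCurve ℤ).baseChange ℚ) 0,
          ∃ a : ℤ, ∃ R ∈ localLayerPointsOfEmb κ (closureEmb (K := ℚ) (v.adicCompletion ℚ)) ((⟨0, 1, 1, -1, -2⟩ : WeierstrassCurve ℤ).baseChange ℚ) 0, P = a • d 0 + 2 • R))
    (hSel : ((⟨0, 1, 1, -1, -2⟩ : WeierstrassCurve ℤ).baseChange ℚ).selmerGroupPInfty 2 = ⊥) (hTam : ¬ 2 ∣ ((⟨0, 1, 1, -1, -2⟩ : WeierstrassCurve ℤ).baseChange ℚ).tamagawaProduct) :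
    ∀ (κ : ZpExtension ℚ 2) (γ : Field.absoluteGaloisGroup ℚ), κ.IsCyclotomic → κ.IsTopGenerator γ →
      ∀ (D : SignedSelmerDualData ((⟨0, 0, 1, -179266824, -2246835136516⟩ : WeierstrassCurve ℤ).baseChange ℚ) κ γ 1) [Module.Finite (IwasawaAlgebra 2) D.X],
        Module.IsTorsion (IwasawaAlgebra 2) D.X ∧ D.mu = 0 := by
  haveI := SSColemanRoad.isElliptic_393129bo1
  haveI := SSColemanRoad.isGloballyMinimal_393129bo1
  have hE := SSColemanRoad.goodSS_two_393129bo1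
  have hA := SSUnitAnchor.goodSS_two_ua627a1
  have hΔ : ((⟨0, 0, 1, -179266824, -2246835136516⟩ : WeierstrassCurve ℤ).baseChange ℚ).Δ < 0 := by
    rw [baseChange_int_Δ, SSColemanRoad.M393129bo1_Δ]; norm_num
  exact muAlgebraicAt_of_partner_honda_descentCertificate _ _ hE.2.2 hE.2.1 hΔ hA.2.2 hA.2.1
    SSUnitAnchor.twoTorsion_congruent_393129bo1_ua627a1 hHonda hSel hTam

/-- **Conjunct 1 of Kμ⁺ AT `499555e1` from the unit anchor `35a1`** (HONDA⁺@2 at the anchor + `Sel_{2^∞}(35a1/ℚ) = 0` +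
`2 ∤ ∏c_ℓ(35a1)`; kernel: reduction data of both curves, `Δ(499555e1) < 0`, `499555e1[2] ≅ 35a1[2]` = `SSUnitAnchor.twoTorsion_congruent_499555e1_ua35a1`).
[cite: GreenbergLNM1716, §3 Prop. 3.8] [cite: GreenbergVatsal2000, Prop. (2.8)] [cite: Kobayashi2003, §8.4, Thm. 9.3] [cite: CremonaAlgorithms1997, Table 1] -/
theorem muAlgebraicAt_499555e1_of_honda_descentCertificate_35a1
    [((⟨0, 1, 1, 9, 1⟩ : WeierstrassCurve ℤ).baseChange ℚ).IsElliptic] [((⟨0, 1, 1, 9, 1⟩ : WeierstrassCurve ℤ).baseChange ℚ).IsGloballyMinimal]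
    (hHonda : ∀ κ : ZpExtension ℚ 2, κ.IsCyclotomic → ∀ (v : HeightOneSpectrum (𝓞 ℚ)), (2 : 𝓞 ℚ) ∈ v.asIdeal →
      ∃ d : ℕ → localPoints ((⟨0, 1, 1, 9, 1⟩ : WeierstrassCurve ℤ).baseChange ℚ) (v.adicCompletion ℚ),
        (∀ m, d m ∈ localLayerPointsOfEmb κ (closureEmb (K := ℚ) (v.adicCompletion ℚ)) ((⟨0, 1, 1, 9, 1⟩ : WeierstrassCurve ℤ).baseChange ℚ) m) ∧
        (∀ m, localTraceOfEmb κ (closureEmb (K := ℚ) (v.adicCompletion ℚ)) ((⟨0, 1, 1, 9, 1⟩ : WeierstrassCurve ℤ).baseChange ℚ) (m + 1) (m + 2) (d (m + 2)) = -d m) ∧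
        (∀ m : ℕ, 1 ≤ m → ∀ P ∈ localLayerPointsOfEmb κ (closureEmb (K := ℚ) (v.adicCompletion ℚ)) ((⟨0, 1, 1, 9, 1⟩ : WeierstrassCurve ℤ).baseChange ℚ) m,
          ∃ B ∈ AddSubgroup.closure (Set.range fun σ : Field.absoluteGaloisGroup (v.adicCompletion ℚ) ↦ σ • d m),
            ∃ P' ∈ localLayerPointsOfEmb κ (closureEmb (K := ℚ) (v.adicCompletion ℚ)) ((⟨0, 1, 1, 9, 1⟩ : WeierstrassCurve ℤ).baseChange ℚ) (m - 1),
            ∃ R ∈ localLayerPointsOfEmb κ (closureEmb (K := ℚ) (v.adicCompletion ℚ)) ((⟨0, 1, 1, 9, 1⟩ : WeierstrassCurve ℤ).baseChange ℚ) m, P = B + P' + 2 • R) ∧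
        (∀ P ∈ localLayerPointsOfEmb κ (closureEmb (K := ℚ) (v.adicCompletion ℚ)) ((⟨0, 1, 1, 9, 1⟩ : WeierstrassCurve ℤ).baseChange ℚ) 0,
          ∃ a : ℤ, ∃ R ∈ localLayerPointsOfEmb κ (closureEmb (K := ℚ) (v.adicCompletion ℚ)) ((⟨0, 1, 1, 9, 1⟩ : WeierstrassCurve ℤ).baseChange ℚ) 0, P = a • d 0 + 2 • R))
    (hSel : ((⟨0, 1, 1, 9, 1⟩ : WeierstrassCurve ℤ).baseChange ℚ).selmerGroupPInfty 2 = ⊥) (hTam : ¬ 2 ∣ ((⟨0, 1, 1, 9, 1⟩ : WeierstrassCurve ℤ).baseChange ℚ).tamagawaProduct) :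
    ∀ (κ : ZpExtension ℚ 2) (γ : Field.absoluteGaloisGroup ℚ), κ.IsCyclotomic → κ.IsTopGenerator γ →
      ∀ (D : SignedSelmerDualData ((⟨0, 0, 1, -164668, -68491061⟩ : WeierstrassCurve ℤ).baseChange ℚ) κ γ 1) [Module.Finite (IwasawaAlgebra 2) D.X],
        Module.IsTorsion (IwasawaAlgebra 2) D.X ∧ D.mu = 0 := by
  haveI := SSColemanRoad.isElliptic_499555e1
  haveI := SSColemanRoad.isGloballyMinimal_499555e1
  have hE := SSColemanRoad.goodSS_two_499555e1
  have hA := SSUnitAnchor.goodSS_two_ua35a1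
  have hΔ : ((⟨0, 0, 1, -164668, -68491061⟩ : WeierstrassCurve ℤ).baseChange ℚ).Δ < 0 := by
    rw [baseChange_int_Δ, SSColemanRoad.M499555e1_Δ]; norm_num
  exact muAlgebraicAt_of_partner_honda_descentCertificate _ _ hE.2.2 hE.2.1 hΔ hA.2.2 hA.2.1
    SSUnitAnchor.twoTorsion_congruent_499555e1_ua35a1 hHonda hSel hTam

end Summit.BirchSwinnertonDyer.BirchSwinnertonDyer.Theorems.SignedMuAtTwo

end
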